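import Summits.AtomisticToContinuum.Crystallization.Theorems.ChargedEnergyGapHalfKernel
import HarnessLib

/-!
# Charged energy gap — lens-3 g65, node «BarlowRef» (R3) — part 26a «GeoKernels»: the three per-source kernels in CLOSED FORM (geometric classes, no enumeration)

Cell `decomp-a2c`, seat lens-3, generation 65.  Imports part 20 v2 (`…HalfKernel`, hence 19 `…IsoKernel` and 18 `…SourceKernel`).  ELEMENTARY·PROVED.
The typed kernels of parts 18/19/20 v2 bound one source's tube-tested row `(Σ_z [test]·d⁻⁶)·V` by a FINITE class sum `Σ_{k<K} vol(class k)·w_k + tail(K)`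
for an arbitrary monotone class sequence.  A certificate that enumerates classes costs ≈ 40 `norm_num` terms per source shell (× 30 shells × bands).  Here the
classes are GEOMETRIC, `β_k = γ·q^k` (`q > 1`), the class volumes are cubic polynomials in `β_k`, so `vol(class k)·β_k⁻⁶ = π·Σ_{n=3..6} c_n·((γq^k)⁻¹)ⁿ`
and the whole class sum is FOUR GEOMETRIC SERIES; letting `K → ∞` kills the tail (`ge_of_tendsto'`).  Result: ONE closed-form expression per regime,
rational in `(γ, q, κ, ρ)` and linear in `π` — a certificate row becomes a single `norm_num` evaluation:

* `geoClassSum γ q n = (γ⁻¹)ⁿ/(1 − (q⁻¹)ⁿ) = Σ_{k≥0} ((γq^k)⁻¹)ⁿ` (`hasSum_geoClass`), the limit tool `le_of_forall_partial`;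
* ★ `inside_geometric_mul_le` (part 19 `inside_kernel_mul_le`, classes from the distance start `γ ≥ 18/5`): `row·V ≤ isoGeo γ q`;
* ★ `half_geometric_mul_le` (part 20 `half_kernel_mul_le`, cap levels `τ_k = ρ·β_k`, `ρ² a² ≤ a² − r²`): `row·V ≤ halfGeo ρ γ q`;
* ★ `source_geometric_mul_le` (part 18 `source_kernel_mul_le`, axial classes: ONE first class `[α₀, γ)` with weight `(max α₀ d₀)⁻⁶`, then geometric
  from `γ ≥ max … d₀`): `row·V ≤ coneVol κ ((κ+1)·9/5) (α₀ − 9/5) (γ + 9/5)·(max α₀ d₀)⁻⁶ + coneGeo κ γ q`.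

The polynomial identities (`iso_/half_/cone_class_term_eq`) are `field_simp; ring`.  0 sorry; standard axioms.
-/

noncomputable section

open scoped Classical RealInnerProductSpace
open Filter Topology
open Literature.MathematicalPhysics.StatisticalMechanics Literature.Geometry.DiscreteGeometry
open Summit.AtomisticToContinuum.Crystallization.Theses.PricedLinkCensus
open Summit.AtomisticToContinuum.Crystallization.Theorems.ChargedEnergyGapNegative

namespace Summit.AtomisticToContinuum.Crystallization.Theorems.ChargedEnergyGapChartDial

section GeoKernels

/-! ## Geometric class sums and the limit tool -/

/-- The GEOMETRIC CLASS SUM `Σ_{k ≥ 0} ((γ·q^k)⁻¹)ⁿ = (γ⁻¹)ⁿ / (1 − (q⁻¹)ⁿ)` in closed form. -/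
def geoClassSum (γ q : ℝ) (n : ℕ) : ℝ := (γ⁻¹) ^ n / (1 - (q⁻¹) ^ n)

/-- `((γ q^k)⁻¹)ⁿ = (γ⁻¹)ⁿ · ((q⁻¹)ⁿ)^k`. [formal bookkeeping] -/
theorem inv_mul_pow_eq (γ q : ℝ) (n k : ℕ) : ((γ * q ^ k)⁻¹) ^ n = (γ⁻¹) ^ n * ((q⁻¹) ^ n) ^ k := by
  rw [mul_inv, mul_pow, ← inv_pow, ← pow_mul, ← pow_mul, mul_comm k n]

/-- The geometric class series converges to the closed form (`q > 1`, `n ≠ 0`), with any constant factor. -/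
theorem hasSum_geoClass {γ q : ℝ} (hq : 1 < q) {n : ℕ} (hn : n ≠ 0) (c : ℝ) :
    HasSum (fun k : ℕ => c * ((γ * q ^ k)⁻¹) ^ n) (c * geoClassSum γ q n) := by
  have hq0 : 0 ≤ q⁻¹ := inv_nonneg.2 (zero_le_one.trans hq.le)
  have hx0 : 0 ≤ (q⁻¹) ^ n := pow_nonneg hq0 n
  have hx1 : (q⁻¹) ^ n < 1 := pow_lt_one₀ hq0 (inv_lt_one_of_one_lt₀ hq) hn
  have h := (hasSum_geometric_of_lt_one hx0 hx1).mul_left (c * (γ⁻¹) ^ n)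
  have hf : (fun k : ℕ => c * ((γ * q ^ k)⁻¹) ^ n) = fun k => c * (γ⁻¹) ^ n * ((q⁻¹) ^ n) ^ k := by
    funext k
    rw [inv_mul_pow_eq, mul_assoc]
  have hv : c * geoClassSum γ q n = c * (γ⁻¹) ^ n * (1 - (q⁻¹) ^ n)⁻¹ := by
    unfold geoClassSum
    rw [div_eq_mul_inv, mul_assoc]
  rw [hf, hv]
  exact h

/-- ★ THE LIMIT TOOL: if `L ≤ A + Σ_{k<K} e_k + t_K` for every `K`, `Σ e_k = E` and `t_K → 0`, then `L ≤ A + E`. -/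
theorem le_of_forall_partial {L A E : ℝ} {e t : ℕ → ℝ} (hE : HasSum e E) (ht : Tendsto t atTop (𝓝 0))
    (h : ∀ K, L ≤ A + ∑ k ∈ Finset.range K, e k + t K) : L ≤ A + E := by
  have h1 : Tendsto (fun K => A + ∑ k ∈ Finset.range K, e k + t K) atTop (𝓝 (A + E + 0)) :=
    (tendsto_const_nhds.add hE.tendsto_sum_nat).add ht
  rw [add_zero] at h1
  exact ge_of_tendsto' h1 h

/-- Geometric classes are monotone. [formal bookkeeping] -/
theorem geo_class_mono {γ q : ℝ} (hγ : 0 ≤ γ) (hq : 1 ≤ q) (k : ℕ) : γ * q ^ k ≤ γ * q ^ (k + 1) :=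
  mul_le_mul_of_nonneg_left (pow_le_pow_right₀ hq (Nat.le_succ k)) hγ

/-! ## The isotropic (inside-the-tube) kernel -/

/-- CLOSED FORM of the isotropic class sum with geometric classes `β_k = γ q^k` (thickening `9/5`). -/
def isoGeo (γ q : ℝ) : ℝ :=
  Real.pi * (4 * (q ^ 3 - 1) / 3) * geoClassSum γ q 3 + Real.pi * (4 * (9 / 5) * (q ^ 2 + 1)) * geoClassSum γ q 4 +
    Real.pi * (4 * (9 / 5) ^ 2 * (q - 1)) * geoClassSum γ q 5 + Real.pi * (8 * (9 / 5) ^ 3 / 3) * geoClassSum γ q 6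

/-- The isotropic class term as four monomials in `u⁻¹`. -/
theorem iso_class_term_eq (u q : ℝ) (hu : u ≠ 0) :
    4 * Real.pi / 3 * ((u * q + 9 / 5) ^ 3 - (u - 9 / 5) ^ 3) * (u⁻¹) ^ 6 =
      Real.pi * (4 * (q ^ 3 - 1) / 3) * (u⁻¹) ^ 3 + Real.pi * (4 * (9 / 5) * (q ^ 2 + 1)) * (u⁻¹) ^ 4 +
        Real.pi * (4 * (9 / 5) ^ 2 * (q - 1)) * (u⁻¹) ^ 5 + Real.pi * (8 * (9 / 5) ^ 3 / 3) * (u⁻¹) ^ 6 := by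
  field_simp
  ring

/-- ★ **INSIDE KERNEL, CLOSED FORM**: for a source `y`, member `c`, tube radius `r`, and a distance start `γ ≥ 18/5` valid on the tube-tested
targets, with geometric classes of any ratio `q > 1`: `(Σ_z [test]·d_yz⁻⁶)·V ≤ isoGeo γ q`. -/
theorem inside_geometric_mul_le {a h : ℝ} {s : ℤ → ℤ} {g : E3 → E3}
    (ha : 9 / 10 ≤ a ∧ a ≤ 11 / 10) (hh : 0 < h ∧ 27 / 50 * a ^ 2 ≤ h ^ 2 ∧ h ^ 2 ≤ 121 / 150 * a ^ 2) (hg : Isometry g)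
    (y c : E3) (r : ℝ) {γ q : ℝ} (hγ : 18 / 5 ≤ γ) (hq : 1 < q)
    (T : Finset E3) (hT : ↑T ⊆ g '' barlowStacking a h s)
    (hTy : ∀ z ∈ T, y ≠ z → Metric.infDist c (segment ℝ y z) ≤ r → γ ≤ dist y z) :
    (∑ z ∈ T, if y ≠ z ∧ Metric.infDist c (segment ℝ y z) ≤ r then (dist y z)⁻¹ ^ 6 else 0) * (a * (a * √3 / 2) * h) ≤ isoGeo γ q := by
  have hγ0 : 0 < γ := by linarith
  have hq0 : 0 < q := by linarith
  have hu : ∀ k : ℕ, γ * q ^ k ≠ 0 := fun k => (mul_pos hγ0 (pow_pos hq0 k)).ne'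
  have hE : HasSum (fun k : ℕ => Real.pi * (4 * (q ^ 3 - 1) / 3) * ((γ * q ^ k)⁻¹) ^ 3 + Real.pi * (4 * (9 / 5) * (q ^ 2 + 1)) * ((γ * q ^ k)⁻¹) ^ 4 +
      Real.pi * (4 * (9 / 5) ^ 2 * (q - 1)) * ((γ * q ^ k)⁻¹) ^ 5 + Real.pi * (8 * (9 / 5) ^ 3 / 3) * ((γ * q ^ k)⁻¹) ^ 6) (isoGeo γ q) := by
    have h3 := hasSum_geoClass (γ := γ) hq (n := 3) (by norm_num) (Real.pi * (4 * (q ^ 3 - 1) / 3))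
    have h4 := hasSum_geoClass (γ := γ) hq (n := 4) (by norm_num) (Real.pi * (4 * (9 / 5) * (q ^ 2 + 1)))
    have h5 := hasSum_geoClass (γ := γ) hq (n := 5) (by norm_num) (Real.pi * (4 * (9 / 5) ^ 2 * (q - 1)))
    have h6 := hasSum_geoClass (γ := γ) hq (n := 6) (by norm_num) (Real.pi * (8 * (9 / 5) ^ 3 / 3))
    have hs := ((h3.add h4).add h5).add h6
    unfold isoGeo
    exact hs
  have ht : Tendsto (fun K : ℕ => 500 * Real.pi / 21 / (γ * q ^ K) ^ 3) atTop (𝓝 0) := by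
    have h3 := (hasSum_geoClass (γ := γ) hq (n := 3) (by norm_num) (500 * Real.pi / 21)).summable.tendsto_atTop_zero
    refine h3.congr fun K => ?_
    simp only [div_eq_mul_inv, inv_pow]
  have hterm : ∀ k : ℕ,
      4 * Real.pi / 3 * ((γ * q ^ (k + 1) + 9 / 5) ^ 3 - (γ * q ^ k - 9 / 5) ^ 3) * (γ * q ^ k)⁻¹ ^ 6 =
        Real.pi * (4 * (q ^ 3 - 1) / 3) * ((γ * q ^ k)⁻¹) ^ 3 + Real.pi * (4 * (9 / 5) * (q ^ 2 + 1)) * ((γ * q ^ k)⁻¹) ^ 4 +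
      Real.pi * (4 * (9 / 5) ^ 2 * (q - 1)) * ((γ * q ^ k)⁻¹) ^ 5 + Real.pi * (8 * (9 / 5) ^ 3 / 3) * ((γ * q ^ k)⁻¹) ^ 6 := by
    intro k
    rw [pow_succ q k, ← mul_assoc, iso_class_term_eq _ _ (hu k)]
  have hK : ∀ K, (∑ z ∈ T, if y ≠ z ∧ Metric.infDist c (segment ℝ y z) ≤ r then (dist y z)⁻¹ ^ 6 else 0) * (a * (a * √3 / 2) * h) ≤
      0 + ∑ k ∈ Finset.range K, (Real.pi * (4 * (q ^ 3 - 1) / 3) * ((γ * q ^ k)⁻¹) ^ 3 + Real.pi * (4 * (9 / 5) * (q ^ 2 + 1)) * ((γ * q ^ k)⁻¹) ^ 4 +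
      Real.pi * (4 * (9 / 5) ^ 2 * (q - 1)) * ((γ * q ^ k)⁻¹) ^ 5 + Real.pi * (8 * (9 / 5) ^ 3 / 3) * ((γ * q ^ k)⁻¹) ^ 6) + 500 * Real.pi / 21 / (γ * q ^ K) ^ 3 := by
    intro K
    have h1 := inside_kernel_mul_le ha hh hg y c r (fun k => γ * q ^ k) K (fun k => geo_class_mono hγ0.le hq.le k)
      (by simpa using hγ) T hT (by simpa using hTy)
    beta_reduce at h1
    rw [Finset.sum_congr rfl fun k _ => hterm k] at h1
    rwa [zero_add]
  have := le_of_forall_partial hE ht hK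
  rwa [zero_add] at this

/-! ## The half-space (near-tube) kernel -/

/-- CLOSED FORM of the half-space class sum: geometric classes `β_k = γ q^k`, cap levels `τ_k = ρ β_k`, thickening `9/5`. -/
def halfGeo (ρ γ q : ℝ) : ℝ :=
  Real.pi * (((q - ρ) ^ 2 * (2 * q + ρ) - (1 - ρ) ^ 2 * (2 + ρ)) / 3) * geoClassSum γ q 3 +
    Real.pi * ((9 / 5) * ((q - ρ) ^ 2 + 4 * (q - ρ) * (2 * q + ρ) + 3 * (1 - ρ) ^ 2) / 3) * geoClassSum γ q 4 +
    Real.pi * (4 * (9 / 5) ^ 2 * q) * geoClassSum γ q 5 + Real.pi * (4 * (9 / 5) ^ 3 / 3) * geoClassSum γ q 6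

/-- The half-space class term as four monomials in `u⁻¹`. -/
theorem half_class_term_eq (u q ρ : ℝ) (hu : u ≠ 0) :
    (capVol (u * q + 9 / 5) (ρ * u - 9 / 5) - capVol (u - 9 / 5) (ρ * u - 9 / 5)) * (u⁻¹) ^ 6 =
      Real.pi * (((q - ρ) ^ 2 * (2 * q + ρ) - (1 - ρ) ^ 2 * (2 + ρ)) / 3) * (u⁻¹) ^ 3 +
        Real.pi * ((9 / 5) * ((q - ρ) ^ 2 + 4 * (q - ρ) * (2 * q + ρ) + 3 * (1 - ρ) ^ 2) / 3) * (u⁻¹) ^ 4 +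
        Real.pi * (4 * (9 / 5) ^ 2 * q) * (u⁻¹) ^ 5 + Real.pi * (4 * (9 / 5) ^ 3 / 3) * (u⁻¹) ^ 6 := by
  unfold capVol
  field_simp
  ring

/-- ★ **HALF-SPACE KERNEL, CLOSED FORM**: source `y` at distance `> r` from the member `c`, cap slope `ρ ≥ 0` with `ρ²·a² ≤ a² − r²`
(`a = dist y c`), distance start `γ ≥ 18/5` valid on the tube-tested targets, any `q > 1`: `(Σ_z [test]·d_yz⁻⁶)·V ≤ halfGeo ρ γ q`. -/
theorem half_geometric_mul_le {a h : ℝ} {s : ℤ → ℤ} {g : E3 → E3}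
    (ha : 9 / 10 ≤ a ∧ a ≤ 11 / 10) (hh : 0 < h ∧ 27 / 50 * a ^ 2 ≤ h ^ 2 ∧ h ^ 2 ≤ 121 / 150 * a ^ 2) (hg : Isometry g)
    {y c : E3} {r : ℝ} (hr : 0 ≤ r) (hry : r < dist y c) {ρ γ q : ℝ} (hρ0 : 0 ≤ ρ)
    (hρ : ρ ^ 2 * dist y c ^ 2 ≤ dist y c ^ 2 - r ^ 2) (hγ : 18 / 5 ≤ γ) (hq : 1 < q)
    (T : Finset E3) (hT : ↑T ⊆ g '' barlowStacking a h s)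
    (hTy : ∀ z ∈ T, y ≠ z → Metric.infDist c (segment ℝ y z) ≤ r → γ ≤ dist y z) :
    (∑ z ∈ T, if y ≠ z ∧ Metric.infDist c (segment ℝ y z) ≤ r then (dist y z)⁻¹ ^ 6 else 0) * (a * (a * √3 / 2) * h) ≤ halfGeo ρ γ q := by
  have hγ0 : 0 < γ := by linarith
  have hq0 : 0 < q := by linarith
  have hu : ∀ k : ℕ, γ * q ^ k ≠ 0 := fun k => (mul_pos hγ0 (pow_pos hq0 k)).ne'
  have hE : HasSum (fun k : ℕ => Real.pi * (((q - ρ) ^ 2 * (2 * q + ρ) - (1 - ρ) ^ 2 * (2 + ρ)) / 3) * ((γ * q ^ k)⁻¹) ^ 3 +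
      Real.pi * ((9 / 5) * ((q - ρ) ^ 2 + 4 * (q - ρ) * (2 * q + ρ) + 3 * (1 - ρ) ^ 2) / 3) * ((γ * q ^ k)⁻¹) ^ 4 +
      Real.pi * (4 * (9 / 5) ^ 2 * q) * ((γ * q ^ k)⁻¹) ^ 5 + Real.pi * (4 * (9 / 5) ^ 3 / 3) * ((γ * q ^ k)⁻¹) ^ 6) (halfGeo ρ γ q) := by
    have h3 := hasSum_geoClass (γ := γ) hq (n := 3) (by norm_num) (Real.pi * (((q - ρ) ^ 2 * (2 * q + ρ) - (1 - ρ) ^ 2 * (2 + ρ)) / 3))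
    have h4 := hasSum_geoClass (γ := γ) hq (n := 4) (by norm_num)
      (Real.pi * ((9 / 5) * ((q - ρ) ^ 2 + 4 * (q - ρ) * (2 * q + ρ) + 3 * (1 - ρ) ^ 2) / 3))
    have h5 := hasSum_geoClass (γ := γ) hq (n := 5) (by norm_num) (Real.pi * (4 * (9 / 5) ^ 2 * q))
    have h6 := hasSum_geoClass (γ := γ) hq (n := 6) (by norm_num) (Real.pi * (4 * (9 / 5) ^ 3 / 3))
    have hs := ((h3.add h4).add h5).add h6
    unfold halfGeo
    exact hs
  have ht : Tendsto (fun K : ℕ => 500 * Real.pi / 21 / (γ * q ^ K) ^ 3) atTop (𝓝 0) := by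
    have h3 := (hasSum_geoClass (γ := γ) hq (n := 3) (by norm_num) (500 * Real.pi / 21)).summable.tendsto_atTop_zero
    refine h3.congr fun K => ?_
    simp only [div_eq_mul_inv, inv_pow]
  have hterm : ∀ k : ℕ, (capVol (γ * q ^ (k + 1) + 9 / 5) (ρ * (γ * q ^ k) - 9 / 5) - capVol (γ * q ^ k - 9 / 5) (ρ * (γ * q ^ k) - 9 / 5)) *
      (γ * q ^ k)⁻¹ ^ 6 = Real.pi * (((q - ρ) ^ 2 * (2 * q + ρ) - (1 - ρ) ^ 2 * (2 + ρ)) / 3) * ((γ * q ^ k)⁻¹) ^ 3 +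
      Real.pi * ((9 / 5) * ((q - ρ) ^ 2 + 4 * (q - ρ) * (2 * q + ρ) + 3 * (1 - ρ) ^ 2) / 3) * ((γ * q ^ k)⁻¹) ^ 4 +
      Real.pi * (4 * (9 / 5) ^ 2 * q) * ((γ * q ^ k)⁻¹) ^ 5 + Real.pi * (4 * (9 / 5) ^ 3 / 3) * ((γ * q ^ k)⁻¹) ^ 6 := by
    intro k
    rw [pow_succ q k, ← mul_assoc, half_class_term_eq _ _ _ (hu k)]
  have hτs : ∀ k : ℕ, (ρ * (γ * q ^ k)) ^ 2 * dist y c ^ 2 ≤ (dist y c ^ 2 - r ^ 2) * (γ * q ^ k) ^ 2 := by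
    intro k
    calc (ρ * (γ * q ^ k)) ^ 2 * dist y c ^ 2 = ρ ^ 2 * dist y c ^ 2 * (γ * q ^ k) ^ 2 := by ring
      _ ≤ (dist y c ^ 2 - r ^ 2) * (γ * q ^ k) ^ 2 := mul_le_mul_of_nonneg_right hρ (sq_nonneg _)
  have hK : ∀ K, (∑ z ∈ T, if y ≠ z ∧ Metric.infDist c (segment ℝ y z) ≤ r then (dist y z)⁻¹ ^ 6 else 0) * (a * (a * √3 / 2) * h) ≤
      0 + ∑ k ∈ Finset.range K, (Real.pi * (((q - ρ) ^ 2 * (2 * q + ρ) - (1 - ρ) ^ 2 * (2 + ρ)) / 3) * ((γ * q ^ k)⁻¹) ^ 3 +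
      Real.pi * ((9 / 5) * ((q - ρ) ^ 2 + 4 * (q - ρ) * (2 * q + ρ) + 3 * (1 - ρ) ^ 2) / 3) * ((γ * q ^ k)⁻¹) ^ 4 +
      Real.pi * (4 * (9 / 5) ^ 2 * q) * ((γ * q ^ k)⁻¹) ^ 5 + Real.pi * (4 * (9 / 5) ^ 3 / 3) * ((γ * q ^ k)⁻¹) ^ 6) + 500 * Real.pi / 21 / (γ * q ^ K) ^ 3 := by
    intro K
    have h1 := half_kernel_mul_le ha hh hg hr hry (fun k => γ * q ^ k) (fun k => ρ * (γ * q ^ k)) K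
      (fun k => geo_class_mono hγ0.le hq.le k) (by simpa using hγ) (fun k => by positivity) hτs T hT (by simpa using hTy)
    beta_reduce at h1
    rw [Finset.sum_congr rfl fun k _ => hterm k] at h1
    rwa [zero_add]
  have := le_of_forall_partial hE ht hK
  rwa [zero_add] at this

/-! ## The cone (tube-regime) kernel -/

/-- CLOSED FORM of the cone class sum from the geometric start `γ`: slope `κ`, thickening `m = (κ+1)·9/5`. -/
def coneGeo (κ γ q : ℝ) : ℝ :=
  Real.pi * (κ ^ 2 * (q ^ 3 - 1) / 3) * geoClassSum γ q 3 +
    Real.pi * (κ ^ 2 * (9 / 5) * (q ^ 2 + 1) + κ * ((κ + 1) * (9 / 5)) * (q ^ 2 - 1)) * geoClassSum γ q 4 +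
    Real.pi * (κ ^ 2 * (9 / 5) ^ 2 * (q - 1) + 2 * κ * ((κ + 1) * (9 / 5)) * (9 / 5) * (q + 1) + ((κ + 1) * (9 / 5)) ^ 2 * (q - 1)) *
      geoClassSum γ q 5 +
    Real.pi * (2 * κ ^ 2 * (9 / 5) ^ 3 / 3 + 2 * ((κ + 1) * (9 / 5)) ^ 2 * (9 / 5)) * geoClassSum γ q 6

/-- The cone class term as four monomials in `u⁻¹` (any thickening `m`). -/
theorem cone_class_term_eq (κ m u q : ℝ) (hu : u ≠ 0) :
    coneVol κ m (u - 9 / 5) (u * q + 9 / 5) * (u⁻¹) ^ 6 =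
      Real.pi * (κ ^ 2 * (q ^ 3 - 1) / 3) * (u⁻¹) ^ 3 + Real.pi * (κ ^ 2 * (9 / 5) * (q ^ 2 + 1) + κ * m * (q ^ 2 - 1)) * (u⁻¹) ^ 4 +
        Real.pi * (κ ^ 2 * (9 / 5) ^ 2 * (q - 1) + 2 * κ * m * (9 / 5) * (q + 1) + m ^ 2 * (q - 1)) * (u⁻¹) ^ 5 +
        Real.pi * (2 * κ ^ 2 * (9 / 5) ^ 3 / 3 + 2 * m ^ 2 * (9 / 5)) * (u⁻¹) ^ 6 := by
  unfold coneVol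
  field_simp
  ring

/-- ★ **CONE KERNEL, CLOSED FORM**: the hypotheses of part 18's `source_kernel_mul_le` (axis `b`, slope `κ` with `r² ≤ κ²(a² − r²)`, axial start
`α₀ > 0` and distance start `d₀` on the tube-tested targets), ONE first axial class `[α₀, γ)` weighted `(max α₀ d₀)⁻⁶`, then geometric classes from
`γ ≥ max(α₀, d₀, 18/5)` with any ratio `q > 1`:
`(Σ_z [test]·d_yz⁻⁶)·V ≤ coneVol κ ((κ+1)·9/5) (α₀ − 9/5) (γ + 9/5)·(max α₀ d₀)⁻⁶ + coneGeo κ γ q`. -/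
theorem source_geometric_mul_le {a h : ℝ} {s : ℤ → ℤ} {g : E3 → E3}
    (ha : 9 / 10 ≤ a ∧ a ≤ 11 / 10) (hh : 0 < h ∧ 27 / 50 * a ^ 2 ≤ h ^ 2 ∧ h ^ 2 ≤ 121 / 150 * a ^ 2) (hg : Isometry g)
    {b : OrthonormalBasis (Fin 3) ℝ E3} {y c : E3} {r d₀ κ : ℝ} (hb : b 2 = (dist y c)⁻¹ • (c - y))
    (hr : 0 ≤ r) (hry : r < dist y c) (hκ : 0 ≤ κ) (hκr : r ^ 2 ≤ κ ^ 2 * (dist y c ^ 2 - r ^ 2))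
    {α₀ γ q : ℝ} (hα0 : 0 < α₀) (hαγ : α₀ ≤ γ) (hdγ : d₀ ≤ γ) (hγ : 18 / 5 ≤ γ) (hq : 1 < q)
    (T : Finset E3) (hT : ↑T ⊆ g '' barlowStacking a h s)
    (hstart : ∀ z ∈ T, y ≠ z → Metric.infDist c (segment ℝ y z) ≤ r → α₀ ≤ ⟪b 2, z - y⟫)
    (hTy : ∀ z ∈ T, y ≠ z → Metric.infDist c (segment ℝ y z) ≤ r → d₀ ≤ dist y z) :
    (∑ z ∈ T, if y ≠ z ∧ Metric.infDist c (segment ℝ y z) ≤ r then (dist y z)⁻¹ ^ 6 else 0) * (a * (a * √3 / 2) * h) ≤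
      coneVol κ ((κ + 1) * (9 / 5)) (α₀ - 9 / 5) (γ + 9 / 5) * (max α₀ d₀)⁻¹ ^ 6 + coneGeo κ γ q := by
  have hγ0 : 0 < γ := by linarith
  have hq0 : 0 < q := by linarith
  have hu : ∀ k : ℕ, γ * q ^ k ≠ 0 := fun k => (mul_pos hγ0 (pow_pos hq0 k)).ne'
  have hγk : ∀ k : ℕ, γ ≤ γ * q ^ k := fun k => le_mul_of_one_le_right hγ0.le (one_le_pow₀ hq.le)
  set m : ℝ := (κ + 1) * (9 / 5) with hm
  have hE : HasSum (fun k : ℕ => Real.pi * (κ ^ 2 * (q ^ 3 - 1) / 3) * ((γ * q ^ k)⁻¹) ^ 3 + Real.pi * (κ ^ 2 * (9 / 5) * (q ^ 2 + 1) + κ * m * (q ^ 2 - 1)) * ((γ * q ^ k)⁻¹) ^ 4 +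
      Real.pi * (κ ^ 2 * (9 / 5) ^ 2 * (q - 1) + 2 * κ * m * (9 / 5) * (q + 1) + m ^ 2 * (q - 1)) * ((γ * q ^ k)⁻¹) ^ 5 +
      Real.pi * (2 * κ ^ 2 * (9 / 5) ^ 3 / 3 + 2 * m ^ 2 * (9 / 5)) * ((γ * q ^ k)⁻¹) ^ 6) (coneGeo κ γ q) := by
    have h3 := hasSum_geoClass (γ := γ) hq (n := 3) (by norm_num) (Real.pi * (κ ^ 2 * (q ^ 3 - 1) / 3))
    have h4 := hasSum_geoClass (γ := γ) hq (n := 4) (by norm_num) (Real.pi * (κ ^ 2 * (9 / 5) * (q ^ 2 + 1) + κ * m * (q ^ 2 - 1)))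
    have h5 := hasSum_geoClass (γ := γ) hq (n := 5) (by norm_num)
      (Real.pi * (κ ^ 2 * (9 / 5) ^ 2 * (q - 1) + 2 * κ * m * (9 / 5) * (q + 1) + m ^ 2 * (q - 1)))
    have h6 := hasSum_geoClass (γ := γ) hq (n := 6) (by norm_num) (Real.pi * (2 * κ ^ 2 * (9 / 5) ^ 3 / 3 + 2 * m ^ 2 * (9 / 5)))
    have hs := ((h3.add h4).add h5).add h6
    unfold coneGeo
    rw [hm] at hs ⊢
    exact hs
  have ht : Tendsto (fun K : ℕ => 128 * Real.pi / 7 * κ ^ 2 / (γ * q ^ K) ^ 3 + 128 * Real.pi / 31 * ((2 * κ + 1) * (9 / 5)) ^ 2 / (γ * q ^ K) ^ 5)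
      atTop (𝓝 0) := by
    have h3 := (hasSum_geoClass (γ := γ) hq (n := 3) (by norm_num) (128 * Real.pi / 7 * κ ^ 2)).summable.tendsto_atTop_zero
    have h5 := (hasSum_geoClass (γ := γ) hq (n := 5) (by norm_num) (128 * Real.pi / 31 * ((2 * κ + 1) * (9 / 5)) ^ 2)).summable.tendsto_atTop_zero
    have hs := h3.add h5
    rw [add_zero] at hs
    refine hs.congr fun K => ?_
    simp only [div_eq_mul_inv, inv_pow]
  -- the class sequence: first class `[α₀, γ)`, then geometric from `γ`
  set α : ℕ → ℝ := fun k => if k = 0 then α₀ else γ * q ^ (k - 1) with hαdef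
  have hα0' : α 0 = α₀ := by simp [hαdef]
  have hαs : ∀ k : ℕ, α (k + 1) = γ * q ^ k := fun k => by simp [hαdef]
  have hmono : ∀ k, α k ≤ α (k + 1) := by
    intro k
    rcases k with _ | k
    · rw [hα0', hαs, pow_zero, mul_one]; exact hαγ
    · rw [hαs, hαs]; exact geo_class_mono hγ0.le hq.le k
  have hterm : ∀ k : ℕ,
      coneVol κ m (α (k + 1) - 9 / 5) (α (k + 1 + 1) + 9 / 5) * (max (α (k + 1)) d₀)⁻¹ ^ 6 = Real.pi * (κ ^ 2 * (q ^ 3 - 1) / 3) * ((γ * q ^ k)⁻¹) ^ 3 + Real.pi * (κ ^ 2 * (9 / 5) * (q ^ 2 + 1) + κ * m * (q ^ 2 - 1)) * ((γ * q ^ k)⁻¹) ^ 4 +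
      Real.pi * (κ ^ 2 * (9 / 5) ^ 2 * (q - 1) + 2 * κ * m * (9 / 5) * (q + 1) + m ^ 2 * (q - 1)) * ((γ * q ^ k)⁻¹) ^ 5 +
      Real.pi * (2 * κ ^ 2 * (9 / 5) ^ 3 / 3 + 2 * m ^ 2 * (9 / 5)) * ((γ * q ^ k)⁻¹) ^ 6 := by
    intro k
    rw [hαs, hαs, max_eq_left (hdγ.trans (hγk k)), pow_succ q k, ← mul_assoc, cone_class_term_eq _ _ _ _ (hu k)]
  have hK : ∀ K, (∑ z ∈ T, if y ≠ z ∧ Metric.infDist c (segment ℝ y z) ≤ r then (dist y z)⁻¹ ^ 6 else 0) * (a * (a * √3 / 2) * h) ≤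
      coneVol κ m (α₀ - 9 / 5) (γ + 9 / 5) * (max α₀ d₀)⁻¹ ^ 6 + ∑ k ∈ Finset.range K, (Real.pi * (κ ^ 2 * (q ^ 3 - 1) / 3) * ((γ * q ^ k)⁻¹) ^ 3 + Real.pi * (κ ^ 2 * (9 / 5) * (q ^ 2 + 1) + κ * m * (q ^ 2 - 1)) * ((γ * q ^ k)⁻¹) ^ 4 +
      Real.pi * (κ ^ 2 * (9 / 5) ^ 2 * (q - 1) + 2 * κ * m * (9 / 5) * (q + 1) + m ^ 2 * (q - 1)) * ((γ * q ^ k)⁻¹) ^ 5 +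
      Real.pi * (2 * κ ^ 2 * (9 / 5) ^ 3 / 3 + 2 * m ^ 2 * (9 / 5)) * ((γ * q ^ k)⁻¹) ^ 6) +
        (128 * Real.pi / 7 * κ ^ 2 / (γ * q ^ K) ^ 3 + 128 * Real.pi / 31 * ((2 * κ + 1) * (9 / 5)) ^ 2 / (γ * q ^ K) ^ 5) := by
    intro K
    have h1 := source_kernel_mul_le ha hh hg hb hr hry hκ hκr α (K + 1) hmono (by rw [hα0']; exact hα0)
      (by rw [hαs]; exact hγ.trans (hγk K)) T hT (by rw [hα0']; exact hstart) hTy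
    rw [Finset.sum_range_succ'] at h1
    beta_reduce at h1
    rw [Finset.sum_congr rfl fun k _ => hterm k, hα0', hαs, hαs, pow_zero, mul_one] at h1
    linarith
  exact le_of_forall_partial hE ht hK

end GeoKernels

end Summit.AtomisticToContinuum.Crystallization.Theorems.ChargedEnergyGapChartDial
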